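import Mathlib
import Literature.Computability.AlgebraicComplexity.PermanentCorrelation
import Literature.Computability.AlgebraicComplexity.SymbolicMatrixDecomposition
import Summits.ValiantsHypothesis.ValiantsHypothesis.Theses.FreeFermionCLL

/-!
# Route `FreeFermionCLL` — `GapRefutesQP` (item stmt-ValiantsHypothesis-13561)

`GapRefutesQP := PMCorrelationGap → TotalRankLeDc → QpArith → ¬ IsQPBounded (n ↦ dc(per_n))`
(the two middle hypotheses are inlined verbatim in the route file).

Pure bookkeeping.  Suppose `dc(per_n) ≤ 2^((log₂ n + c)^c)` for all `n`.  `QpArith` turns the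
size bound `R ≤ n² · dc(per_n)` of the principal-minor representation
`per_n(x + J) = n! · det(I_R + diag(x ∘ κ) K)` supplied by `TotalRankLeDc` into
`R ≤ 2^((log₂ n + c')^c')`, so `PMCorrelationGap` (at `c'`, at its own threshold `n₀`) applies to
`P = det(I_R + diag(x ∘ κ) K)`: `2 · |permMass(P^(n))|² ≤ n! · coeffNormSq(P^(n))`.  But the
degree-`n` component of `per_n(x + J)` is `per_n` itself (`per_n` is homogeneous of degree `n` and
translation does not change the top homogeneous component —
`Literature.Computability.AlgebraicComplexity.weightedHomogeneousComponent_translate`), so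
`P^(n) = per_n / n!`, whose permutation mass is `1` and whose coefficient norm is `1/n!`: the
inequality reads `2 ≤ 1`.
-/

-- `Summit.ValiantsHypothesis.ValiantsHypothesis.…` is the tree's mandated single-conjunct layout
-- (Sub = Summit), so the duplicated namespace component is intended.
set_option linter.dupNamespace false

namespace Summit.ValiantsHypothesis.ValiantsHypothesis.Theorems.FreeFermionCLL

open MvPolynomial
open Literature.Computability.AlgebraicComplexity
open Summit.ValiantsHypothesis.ValiantsHypothesis.Theses.FreeFermionCLL

/-- The top homogeneous component of the translated permanent `per_n(x + J)` is `per_n`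
(`per_n` is homogeneous of degree `n`; translation preserves the top component). [folklore] -/
theorem homogeneousComponent_aeval_X_add_one_perPoly (n : ℕ) :
    homogeneousComponent n (aeval (fun e => X e + 1) (perPoly (Fin n) ℂ)) = perPoly (Fin n) ℂ := by
  have hhom : (perPoly (Fin n) ℂ).IsHomogeneous n := by
    simpa using (perPoly_isHomogeneous (n := Fin n) (k := ℂ))
  have h := weightedHomogeneousComponent_translate (σ := Fin n × Fin n) (1 : Fin n × Fin n → ℕ)
    (AddMonoidHom.id ℕ) (fun _ => rfl) (fun _ => (1 : ℂ)) hhom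
  have e : aeval (fun e => X e + 1) (perPoly (Fin n) ℂ) =
      eval₂Hom C (fun v => X v + C ((fun _ => (1 : ℂ)) v)) (perPoly (Fin n) ℂ) := by
    rw [aeval_eq_eval₂Hom, algebraMap_eq]
    simp only [C_1]
  rw [e]
  exact h

/-- If `per_n(x + J) = n! · P` then the degree-`n` homogeneous component of `P` is `per_n / n!`.
[folklore] -/
theorem homogeneousComponent_eq_of_repr (n : ℕ) {P : MvPolynomial (Fin n × Fin n) ℂ}
    (h : aeval (fun e => X e + 1) (perPoly (Fin n) ℂ) = C (n.factorial : ℂ) * P) :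
    homogeneousComponent n P = C ((n.factorial : ℂ)⁻¹) * perPoly (Fin n) ℂ := by
  have h1 : C (n.factorial : ℂ) * homogeneousComponent n P = perPoly (Fin n) ℂ := by
    rw [← homogeneousComponent_C_mul, ← h, homogeneousComponent_aeval_X_add_one_perPoly]
  have hne : (n.factorial : ℂ) ≠ 0 := Nat.cast_ne_zero.2 (Nat.factorial_ne_zero n)
  rw [← h1, ← mul_assoc, ← C_mul, inv_mul_cancel₀ hne, C_1, one_mul]

/-- `permMass n (per_n / n!) = 1`. [folklore] -/
theorem permMass_C_inv_factorial_mul_perPoly (n : ℕ) :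
    permMass n (C ((n.factorial : ℂ)⁻¹) * perPoly (Fin n) ℂ) = 1 := by
  rw [permMass_C_mul, permMass_perPoly,
    inv_mul_cancel₀ (Nat.cast_ne_zero.2 (Nat.factorial_ne_zero n))]

/-- `n! · coeffNormSq n (per_n / n!) = 1`. [folklore] -/
theorem factorial_mul_coeffNormSq_C_inv_factorial_mul_perPoly (n : ℕ) :
    (n.factorial : ℝ) * coeffNormSq n (C ((n.factorial : ℂ)⁻¹) * perPoly (Fin n) ℂ) = 1 := by
  rw [C_mul', coeffNormSq_smul, coeffNormSq_perPoly, norm_inv, Complex.norm_natCast]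
  have hne : (n.factorial : ℝ) ≠ 0 := Nat.cast_ne_zero.2 (Nat.factorial_ne_zero n)
  field_simp

/-- **Item `GapRefutesQP`** (stmt-ValiantsHypothesis-13561): the correlation gap `X`, the
principal-minor normal form of size `≤ n² · dc(per_n)` and the quasi-polynomial arithmetic glue
together refute a quasi-polynomial bound on `dc(per_n)`. [folklore] -/
theorem gapRefutesQP_proof : GapRefutesQP := by
  intro hX hT hQ hqp
  obtain ⟨c, hc⟩ := hqp
  obtain ⟨c', hc'⟩ := hQ c
  obtain ⟨n₀, hn₀⟩ := hX c'
  obtain ⟨R, hR, K, κ, hrepr⟩ := hT n₀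
  have hRle : R ≤ 2 ^ ((Nat.log 2 n₀ + c') ^ c') :=
    hR.trans ((Nat.mul_le_mul_left _ (hc n₀)).trans (hc' n₀))
  have hineq := hn₀ n₀ le_rfl R hRle K κ
  rw [homogeneousComponent_eq_of_repr n₀ hrepr, permMass_C_inv_factorial_mul_perPoly,
    factorial_mul_coeffNormSq_C_inv_factorial_mul_perPoly] at hineq
  norm_num at hineq

end Summit.ValiantsHypothesis.ValiantsHypothesis.Theorems.FreeFermionCLL
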